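import Literature.AlgebraicGeometry.HodgeTheory.DivisorCupRaisesGeometricConiveau
import Literature.AlgebraicGeometry.HodgeTheory.ChernCharacterBetti
import Literature.AlgebraicTopology.SingularHomology.GysinMapSupportProofs
import HarnessLib

/-!
# Geometric coniveau descends along a morphism with a divisor-power Gysin section (projective bundles)

W. Fulton, *Intersection Theory* (2nd ed. 1998), §3.1 Prop. 3.1 (a): for the projective bundle
`p : P(E) → X` of a vector bundle of rank `e + 1` and `ξ = c₁(𝒪(1))`, "`p_*(ξᵉ ∩ p^*α) = α`" — the
Gysin push-forward of `ξᵉ` is the identity (`p_* ξᵉ = 1`), and this persists for the complete flag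
bundle `Fl(E) → X` (an iterated projective bundle: the splitting construction, §3.2). Together with
C. Voisin, *Hodge and generalized Hodge conjectures* (2025), §4.3 — cup product with a divisor class
raises the geometric coniveau by one (the tree's UNCONDITIONAL
`cupProduct_mem_supportedClasses_succ_of_mem_algebraicClasses_one_right`) and a Gysin push-forward
along `f : Y → X`, `dim Y = dim X + d`, lowers it by `d` (`complexGysin_mem_supportedClasses`) — this
gives the DESCENT of coniveau along such morphisms:

* `cupProduct_cupPowTwo_mem_supportedClasses` — `y ∈ Nᶜ Hᵏ(Y)`, `ξ` a divisor class ⟹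
  `y ∪ ξᵈ ∈ Nᶜ⁺ᵈ Hᵏ⁺²ᵈ(Y)`;
* **`mem_supportedClasses_of_map_mem_of_complexGysin_cupPowTwo`** — if `f : Y ⟶ X` is a morphism of
  smooth projective complex varieties, `dim Y = dim X + d`, `ξ ∈ N¹ H²(Y(ℂ); ℂ)` with `f_*(ξᵈ) = 1`,
  then `f^* x ∈ Nᶜ Hᵏ(Y(ℂ); ℂ)` implies `x ∈ Nᶜ Hᵏ(X(ℂ); ℂ)`: indeed
  `x = x ∪ f_* ξᵈ = f_*(f^* x ∪ ξᵈ)` (projection formula `complexGysin_cup`) with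
  `f^* x ∪ ξᵈ ∈ Nᶜ⁺ᵈ(Y)`.

Use: the reduction of the algebraicity of the Chern character of an arbitrary vector bundle
(`ChernCharacterBetti.ch_mem_algebraicClasses`) to bundles with a full flag (proved for analytification
data in `Summits/HodgeConjecture/…/EightfoldBlochSeedsChernCharacterOnBettiAnalytificationFlag`) along
the flag bundle `Fl(E) → X`. Everything is proved; no definitions, no named facts.

## References

* [Fulton1998] W. Fulton, *Intersection Theory*, 2nd ed. (1998), §3.1 Prop. 3.1 (a), §3.2.
* [Voisin2025] C. Voisin, *Hodge and generalized Hodge conjectures, coniveau and algebraic cycles*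
  (2025), §4.1 Example 4.2, §4.3.
* [FultonYoungTableaux1997] W. Fulton, *Young Tableaux* (1997), App. B §B.1 (5)–(6) (Gysin maps,
  projection formula).
-/

noncomputable section

open CategoryTheory AlgebraicGeometry
open Literature.AlgebraicTopology.SingularHomology Literature.AlgebraicGeometry.Motives

namespace Literature.AlgebraicGeometry.HodgeTheory

variable {m n : ℕ} {Y X : SchemeOver ℂ}

/-- **`y ∪ ξᵈ ∈ Nᶜ⁺ᵈ` for `y ∈ Nᶜ` and a divisor class `ξ`** (Voisin 2025 §4.3, one power at a
time: `Nᶜ ∪ N¹ ⊆ Nᶜ⁺¹`, and `ξᵈ⁺¹ = ξᵈ ∪ ξ`). [cite: Voisin2025, §4.1 Example 4.2 and §4.3] -/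
theorem cupProduct_cupPowTwo_mem_supportedClasses (hY : IsSmoothProjective m Y) {ξ : complexBetti Y 2}
    (hξ : ξ ∈ algebraicClasses Y 1) {k c : ℕ} {y : complexBetti Y k} (hy : y ∈ supportedClasses Y k c) :
    ∀ d : ℕ, cupProduct (rfl : k + 2 * d = k + 2 * d) y (cupPowTwo ξ d) ∈ supportedClasses Y (k + 2 * d) (c + d)
  | 0 => by
    have h : cupProduct (rfl : k + 2 * 0 = k + 2 * 0) y (cupPowTwo ξ 0) = y := cupProduct_one y
    rw [h]
    exact hy
  | d + 1 => by
    have ih := cupProduct_cupPowTwo_mem_supportedClasses hY hξ hy d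
    rw [cupPowTwo_succ, ← cupProduct_assoc (rfl : k + 2 * d = k + 2 * d) (two_mul_add_two d)
      (show k + 2 * d + 2 = k + 2 * (d + 1) by omega) rfl]
    exact cupProduct_mem_supportedClasses_succ_of_mem_algebraicClasses_one_right hY _ ih hξ

/-- **Coniveau descends along a morphism with a divisor-power Gysin section.** For a morphism
`f : Y ⟶ X` of smooth projective complex varieties with `dim Y = dim X + d` and a divisor class
`ξ ∈ N¹ H²(Y(ℂ); ℂ)` with `f_*(ξᵈ) = 1 ∈ H⁰(X(ℂ); ℂ)` (e.g. a projective bundle with `ξ = c₁(𝒪(1))`,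
Fulton Prop. 3.1 (a), or the complete flag bundle), a class `x ∈ Hᵏ(X(ℂ); ℂ)` whose pull-back has
geometric coniveau `≥ c` has geometric coniveau `≥ c`:
`x = x ∪ f_* ξᵈ = f_*(f^* x ∪ ξᵈ) ∈ f_*(Nᶜ⁺ᵈ H(Y)) ⊆ Nᶜ H(X)`. [cite: Fulton1998, §3.1 Prop. 3.1 (a)]
[cite: Voisin2025, §4.3] [cite: FultonYoungTableaux1997, App. B §B.1 (5)–(6)] -/
theorem mem_supportedClasses_of_map_mem_of_complexGysin_cupPowTwo (μ : OrientationFamily)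
    (hμ : μ.HasPoincareDuality) (hY : IsSmoothProjective m Y) (hX : IsSmoothProjective n X) (f : Y ⟶ X)
    {d : ℕ} (hmd : n + d = m) {ξ : complexBetti Y 2} (hξ : ξ ∈ algebraicClasses Y 1)
    (hone : complexGysin μ hY hX f (show 2 * d + 2 * n = 0 + 2 * m by omega) (cupPowTwo ξ d) =
      singularCohomology.one ℂ (ComplexPoints X))
    {k c : ℕ} {x : complexBetti X k} (hx : complexBetti.map f k x ∈ supportedClasses Y k c) :
    x ∈ supportedClasses X k c := by
  have h1 := cupProduct_cupPowTwo_mem_supportedClasses hY hξ hx d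
  have h2 := complexGysin_mem_supportedClasses (gysinMap_restrictCompl_eq_zero_of_field ℂ) μ hμ hY hX f
    (show k + 2 * d + 2 * n = k + 2 * m by omega) (show c + m ≤ n + (c + d) by omega) h1
  have h3 : complexGysin μ hY hX f (show k + 2 * d + 2 * n = k + 2 * m by omega)
      (cupProduct (rfl : k + 2 * d = k + 2 * d) (complexBetti.map f k x) (cupPowTwo ξ d)) = x := by
    rw [complexGysin_cup hμ hY hX f rfl _ (show 2 * d + 2 * n = 0 + 2 * m by omega) (Nat.add_zero k)
      x (cupPowTwo ξ d), hone]
    exact cupProduct_one x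
  rw [← h3]
  exact h2

/-- **In particular for algebraic classes**: `f^* x ∈ algebraicClasses Y p ⟹ x ∈ algebraicClasses X p`
for such `f` (degree `2p`, coniveau `p`). [cite: Fulton1998, §3.1 Prop. 3.1 (a)] [cite: Voisin2025, §4.3] -/
theorem mem_algebraicClasses_of_map_mem_of_complexGysin_cupPowTwo (μ : OrientationFamily)
    (hμ : μ.HasPoincareDuality) (hY : IsSmoothProjective m Y) (hX : IsSmoothProjective n X) (f : Y ⟶ X)
    {d : ℕ} (hmd : n + d = m) {ξ : complexBetti Y 2} (hξ : ξ ∈ algebraicClasses Y 1)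
    (hone : complexGysin μ hY hX f (show 2 * d + 2 * n = 0 + 2 * m by omega) (cupPowTwo ξ d) =
      singularCohomology.one ℂ (ComplexPoints X))
    {p : ℕ} {x : complexBetti X (2 * p)} (hx : complexBetti.map f (2 * p) x ∈ algebraicClasses Y p) :
    x ∈ algebraicClasses X p :=
  mem_supportedClasses_of_map_mem_of_complexGysin_cupPowTwo μ hμ hY hX f hmd hξ hone hx

/-- **Descent with a non-zero scalar**: the same when `f_*(ξᵈ) = a · 1` for some `a ≠ 0` (the sign /
normalisation of the Gysin push-forward of `ξᵈ` is immaterial for the coniveau, a `ℂ`-subspace):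
`x = a⁻¹ • f_*(f^* x ∪ ξᵈ)`. [cite: Fulton1998, §3.1 Prop. 3.1 (a)] [cite: Voisin2025, §4.3] -/
theorem mem_supportedClasses_of_map_mem_of_complexGysin_cupPowTwo_eq_smul (μ : OrientationFamily)
    (hμ : μ.HasPoincareDuality) (hY : IsSmoothProjective m Y) (hX : IsSmoothProjective n X) (f : Y ⟶ X)
    {d : ℕ} (hmd : n + d = m) {ξ : complexBetti Y 2} (hξ : ξ ∈ algebraicClasses Y 1) {a : ℂ} (ha : a ≠ 0)
    (hone : complexGysin μ hY hX f (show 2 * d + 2 * n = 0 + 2 * m by omega) (cupPowTwo ξ d) =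
      a • singularCohomology.one ℂ (ComplexPoints X))
    {k c : ℕ} {x : complexBetti X k} (hx : complexBetti.map f k x ∈ supportedClasses Y k c) :
    x ∈ supportedClasses X k c := by
  have h1 := cupProduct_cupPowTwo_mem_supportedClasses hY hξ hx d
  have h2 := complexGysin_mem_supportedClasses (gysinMap_restrictCompl_eq_zero_of_field ℂ) μ hμ hY hX f
    (show k + 2 * d + 2 * n = k + 2 * m by omega) (show c + m ≤ n + (c + d) by omega) h1
  have h3 : complexGysin μ hY hX f (show k + 2 * d + 2 * n = k + 2 * m by omega)
      (cupProduct (rfl : k + 2 * d = k + 2 * d) (complexBetti.map f k x) (cupPowTwo ξ d)) = a • x := by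
    rw [complexGysin_cup hμ hY hX f rfl _ (show 2 * d + 2 * n = 0 + 2 * m by omega) (Nat.add_zero k)
      x (cupPowTwo ξ d), hone, map_smul]
    exact congrArg (a • ·) (cupProduct_one x)
  have h4 : x = a⁻¹ • (a • x) := by rw [smul_smul, inv_mul_cancel₀ ha, one_smul]
  rw [h4, ← h3]
  exact Submodule.smul_mem _ _ h2

/-- The scalar form for algebraic classes: `f^* x ∈ algebraicClasses Y p ⟹ x ∈ algebraicClasses X p`
when `f_*(ξᵈ) = a · 1`, `a ≠ 0`. [cite: Fulton1998, §3.1 Prop. 3.1 (a)] [cite: Voisin2025, §4.3] -/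
theorem mem_algebraicClasses_of_map_mem_of_complexGysin_cupPowTwo_eq_smul (μ : OrientationFamily)
    (hμ : μ.HasPoincareDuality) (hY : IsSmoothProjective m Y) (hX : IsSmoothProjective n X) (f : Y ⟶ X)
    {d : ℕ} (hmd : n + d = m) {ξ : complexBetti Y 2} (hξ : ξ ∈ algebraicClasses Y 1) {a : ℂ} (ha : a ≠ 0)
    (hone : complexGysin μ hY hX f (show 2 * d + 2 * n = 0 + 2 * m by omega) (cupPowTwo ξ d) =
      a • singularCohomology.one ℂ (ComplexPoints X))
    {p : ℕ} {x : complexBetti X (2 * p)} (hx : complexBetti.map f (2 * p) x ∈ algebraicClasses Y p) :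
    x ∈ algebraicClasses X p :=
  mem_supportedClasses_of_map_mem_of_complexGysin_cupPowTwo_eq_smul μ hμ hY hX f hmd hξ ha hone hx

end Literature.AlgebraicGeometry.HodgeTheory

end
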